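import Mathlib
import HarnessLib
import HarnessLib.Audit
import Summits.AtomisticToContinuum.Statement
import Literature.MathematicalPhysics.StatisticalMechanics.OneCrossingMixture
import Literature.MathematicalPhysics.StatisticalMechanics.BarlowStackingEnergy
import HarnessLib.Audit.Status.Attr

/-!
Route: OneCrossingRisingSea

DORMANT since 2026-08-23T12:48:25Z (reconciler: no traction for 6.1 d (last activity item-evidence-added at 2026-08-17T10:24:02Z); parked, not closed — `ledger route dormant route-AtomisticToContinuum-OneCrossingRisingSea --off` to reac) — unstaffed, not closed; items shared with open routes are served there. `ledger route dormant <id> --off` reactivates.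

# Route OneCrossingRisingSea — one sign change of the Bernstein measure — stable one-crossing
Gaussian mixtures crystallize in ℝ³, and Lennard-Jones is one (conforming successor of
OneSignChangeClass)

RISING-SEA thesis realising card one-sign-change-class (its L3a), re-opened CONFORMING (D-0027 §2.1)
after the retired
route OneSignChangeClass (same card, 2026-08-15T11:27Z; closed 13:45Z `not-a-thesis` only because
its assembly named the
Literature decl instead of the sub-problem decl `_root_.Crystallization`; nothing was refuted, its
review said KEEP OPEN).
Call a pair potential V CLASS 1 when `IsOneCrossingMixture V` (the Literature predicate that landed
from that route:
V(r) = ∫_0^∞ e^(-t r²) w(t) dt with a density w ≤ 0 on (0,t₀), ≥ 0 on [t₀,∞) — ONE sign change,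
attraction = long range,
repulsion = short range) and V has a divergent core, a negative value, a summable tail |V(r)| ≤ C
r^-(3+ε) (r ≥ 1) and is
stable in ℝ³. It suffices to show X = ClassOneCrystallizes: EVERY class-1 potential satisfies
HasPeriodicGroundStateEnergy V 3 ∧ IsCrystallizing V 3. X = X_E ∧ X_P with X_E = ClassOneEnergy
(energetic form for the
class) and X_P = ClassOnePositional (Blanc–Lewin form given the energetic one); Lennard-Jones is
class 1
(LennardJonesClassOne: first conjunct = the PROVED Literature theorem
isOneCrossingMixture_lennardJones, w(t) = t⁵/1440 − t²/12,
t₀ = 120^(1/3); stability = the PROVED fact lennardJones_stable_holds), so the deciding theorem is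
instantiation:
`closes hE hP hLJ : _root_.Crystallization := ⟨hE _ hLJ, hP _ hLJ (hE _ hLJ)⟩` (sorry-free in
Sketch.lean).
Lean: `∀ V : ℝ → ℝ, (Literature.MathematicalPhysics.StatisticalMechanics.IsOneCrossingMixture V ∧
Filter.Tendsto V (nhdsWithin 0 (Set.Ioi 0)) Filter.atTop ∧ (∃ r : ℝ, 0 < r ∧ V r < 0) ∧ (∃ C ε : ℝ,
0 < ε ∧ ∀ r : ℝ, 1 ≤ r → |V r| ≤ C * r ^ (-(3 + ε))) ∧ (∃ B : ℝ, ∀ (N : ℕ) (x : Fin N →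
EuclideanSpace ℝ (Fin 3)), Function.Injective x → -(B * (N : ℝ)) ≤
Literature.MathematicalPhysics.StatisticalMechanics.interactionEnergy V x)) →
Literature.MathematicalPhysics.StatisticalMechanics.HasPeriodicGroundStateEnergy V 3 ∧
Literature.MathematicalPhysics.StatisticalMechanics.IsCrystallizing V 3`

## Assembly
Pure logic, checked sorry-free in the planner's Sketch.lean (closes / assembly_proof; axioms
propext, Classical.choice, Quot.sound):
instantiate ClassOneEnergy and ClassOnePositional at V = lennardJones with the witness
LennardJonesClassOne (its statement is
literally the class-1 hypothesis at lennardJones); the pair of conclusions is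
`_root_.Crystallization` (an abbrev of the
Literature conjunction, matched by the anonymous constructor). The deciding theorem `closes` takes
exactly these three items as
hypotheses; ClassOneCrystallizes (target) is their conjunction up to logic (target_of_cruxes /
cruxes_of_target in Sketch.lean);
ClassOneStackingPeriodic and the three lemma supports are not in the implication chain: they are the
foreseen children /
structural inputs of ClassOneEnergy (Two-layer plan), filed now because they are the attackable
statements of the line.

Rationale: WHY THIS LINE. Mechanism: total positivity of the Laplace kernel e^(-ts) (Karlin1968; PolyaSzego1925
Part V) applied to the signed
Bernstein–Widder measure of the potential; the invariant is the NUMBER OF SIGN CHANGES of w,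
imported from the theory of
sign-regular kernels into the crystallization problem. One crossing is the one structural fact about
r⁻¹²/12 − r⁻⁶/6 that
survives every averaging the problem performs (radial derivative, layer sums, theta functions,
Fourier transform), by a
three-line monotonicity argument (e^(t₀ s)·∫ e^(-ts) dm(t) is non-increasing in s when m ≤ 0 below
t₀ and ≥ 0 above): class-1
potentials have exactly one well (ClassOneSingleWell), their Barlow registry couplings J_k change
sign at most once, + … + − − …
(ClassOneRegistryOneCrossing), and theta-ordered pairs of structures (fcc/hcp, BeterminPetrache2017)
exchange stability exactly
once along the class — no second length scale in real space, no second ring in Fourier space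
(LifshitzPetrich1997), no
re-entrance: none of the known mechanisms for one-component aperiodic order (Dzugutov1993,
EngelTrebin2007, EngelEtAl2014) is
available inside class 1. The lattice-energy literature already organises LATTICE theorems by the
sign structure of the
inverse-Laplace measure (Betermin2015 §4, BeterminPetrache2019 Thm 1.5, BeterminSamajTravenec2022
§3.1, BeterminSamajTravenec2024
§2), but nobody has made the sign-change COUNT the hypothesis of a crystallization statement over
all configurations. What the
line does that the open Crystallization routes (BrittleRungDescent, PoissonBesselStacking,
LuttingerTiszaRegistry,
HcpThetaUniversality, …) do not: they are Lennard-Jones-specific and numerical at the decisive step;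
this one states the
conjunct at the generality where it is FALSIFIABLE by other potentials (the card's census) and
supplies class-wide structural
lemmas the certificate routes can cite against "exotic competitor" objections. Versus the retired
predecessor: items are now
stated over the landed predicate, the LJ membership rests on two proved tree facts, the reviewer's
recommended domination child
is filed (DominatedRegistrySelectsHcp), and the glue concludes `_root_.Crystallization` by name.

RANKED CRUXES. #0 ClassOneCrystallizes (target) — X: every class-1 pair potential (one-crossing
Gaussian mixture with divergent core, a negative value, summable tail r^-(3+ε) and stability in ℝ³)
has a periodic minimiser of the energy per particle to which E(N)/N converges, and its ground states
converge locally, up to translations and subsequences, to a non-zero periodic point measure (card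
L3a; Lennard-Jones and Mie (n,m) with n > m > 3 are members, double-Yukawa in its stable range v₁κ₂²
≥ v₂κ₁² too; Morse is not (finite core), Buckingham exp-6 is not (two sign changes, no lower bound);
the class allows bcc — periodic, not Barlow — for soft members). (why it might fail: asserts 3-D
crystallization for a whole class with arbitrarily soft members (cores ~ r^-3.1, tails ~ −r^-3.05);
one class-1 potential with a quasicrystalline or infinitely degenerate aperiodic ground state — none
known, none excluded — refutes it.) [Betermin2015, BeterminPetrache2019, BlancLewin2015,
LifshitzPetrich1997, EngelEtAl2014]
#2 ClassOnePositional (crux) — X_P: for every class-1 potential V, the energetic form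
HasPeriodicGroundStateEnergy V 3 implies the Blanc–Lewin positional form IsCrystallizing V 3 (card
L3a, positional half; the step where "one length scale ⇒ no aperiodic order" must become a rigidity
theorem). [deps: ClassOneEnergy] [difficulty: open-problem] (why it might fail: 3-D positional
rigidity for PAIR potentials is unknown even for Lennard-Jones (Flatley–Theil need a three-body
term); at the fcc/hcp balance point of the class, or for soft tails, degenerate stackings are exact
minimisers and translated ground states need not settle on one periodic pattern.) [BlancLewin2015,
FlatleyTheil2015, Theil2006, BeterminPetrache2019]
#3 ClassOneEnergy (crux) — X_E: for every class-1 potential V, the minimum of the energy per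
particle over periodic configurations of ℝ³ is attained and E(N)/N converges to it (card L3a,
energetic half; for Lennard-Jones this is the conjunct's first half with hcp-type expected, for soft
members bcc or fcc — the class does not promise close packing). [difficulty: open-problem] (why it
might fail: attainment can fail inside class 1: for soft members the registry couplings are + for k
< k₀ (k₀ ≥ 4) then −, a frustrated ANNNI-type chain whose optimal period may diverge at multiphase
points (FisherSzpilka1987, BakBruinsma1982); non-Barlow competitors for soft cores are untested.)
[BlancLewin2015, BeterminSamajTravenec2022, BeterminPetrache2019, FisherSzpilka1987, Hubbard1978,
BakBruinsma1982]
#4 ClassOneStackingPeriodic (crux) — for every class-1 potential V and every ideal Barlow geometry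
(in-layer spacing a > 0, layer spacing h with h² = 2a²/3), the one-dimensional stacking model with
couplings J_k = barlowCoupling V a h k (aligned minus non-aligned layer interaction) has a PERIODIC
Hägg sequence minimising the stacking energy density haggStackingEnergy among all Hägg sequences —
the class-wide form of stacking selection, whose only structural input is the one-crossing sign
pattern of J (ClassOneRegistryOneCrossing); in the dominated corner J₂ + Σ_(k≥3)(k−1)|J_k| ≤ 0 it is
DominatedRegistrySelectsHcp (witness: ABAB, period 2); foreseen child of ClassOneEnergy. [deps:
ClassOneRegistryOneCrossing, DominatedRegistrySelectsHcp] [difficulty: L] (why it might fail: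
frustration: if J₂, J₃ > 0 > J₄,… no Barlow stacking avoids every penalty (pigeonhole on 4 layers)
and the infinite-range tail may push the optimal period to infinity at multiphase points
(FisherSzpilka1987, Hubbard1978 barrier); "every a" includes unphysical densities.)
[FisherSzpilka1987, RadinSchulman1983, Hubbard1978, BeterminPetrache2017, PartayOrtnerCsanyi2017,
RegevStephensdavidowitz2017]
#9 LennardJonesClassOne (support) — Lennard-Jones is class 1: IsOneCrossingMixture lennardJones
(PROVED in tree: isOneCrossingMixture_lennardJones, density t⁵/1440 − t²/12, t₀ = 120^(1/3));
divergent core (r⁻¹²/12 dominates as r → 0⁺); V(1) = −1/12 < 0 (lennardJones_one); |V(r)| ≤ r⁻⁶/4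
for r ≥ 1 (ε = 3); stability in ℝ³ = lennardJones_stable_holds 3 (PROVED, StablePotentialsProofs).
The only hypothesis of `closes` that is not a conjecture. [difficulty: provable-now]
[BlancLewin2015, BeterminPetrache2019, Schoenberg1938]
#9 ClassOneSingleWell (support) — one crossing in real space (card L1, real half): a one-crossing
Gaussian mixture with divergent core and a negative value has exactly one well — there is r₀ > 0
with V strictly decreasing on (0, r₀] and strictly increasing on [r₀, ∞) (no shoulder, no bump, no
second minimum: the Dzugutov / Lennard-Jones–Gauss mechanisms for one-component quasicrystals are
unavailable in class 1). Proof sketch: V′(r) = −2r g(r²), g(s) = ∫ t e^(-ts) w(t) dt, and e^(t₀ s)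
g(s) is strictly decreasing; V → 0 at ∞ by dominated convergence, so the crossing of g exists.
[difficulty: M] [Karlin1968, PolyaSzego1925, Schoenberg1938, Dzugutov1993, EngelTrebin2007]
#9 ClassOneRegistryOneCrossing (support) — one crossing survives the layer sums (card L1/L2 engine):
for a one-crossing Gaussian mixture V with summable tail and any triangular-layer geometry a, h > 0,
the registry couplings k ↦ J_k = barlowCoupling V a h k (k ≥ 1) change sign at most once and only
from + to −: J_(k₁) ≤ 0 ⇒ J_(k₂) ≤ 0 for k₂ ≥ k₁. Proof sketch: J_k = D(kh), D(z) = ∫ e^(-t z²) F(t)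
w(t) dt with F(t) = Θ_Λ(t) − Θ_(Λ+w)(t) ≥ 0 (shifted-Gaussian-mass inequality,
RegevStephensdavidowitz2017 Thm 1.1 / BeterminPetrache2017; for the triangular lattice it reduces to
two rectangular sublattices and Mathlib's jacobiTheta₂ functional equation), and s ↦ e^(t₀ s) D(√s)
is non-increasing. [difficulty: M] [RegevStephensdavidowitz2017, BeterminPetrache2017, Karlin1968,
PolyaSzego1925]
#9 DominatedRegistrySelectsHcp (support) — Hägg domination, infinite volume (the reviewer's
recommended child of ClassOneStackingPeriodic; restates the superseded route
RefuteCrystalPeriodicMin's item 0671 RefuteCrys1dGroundstate over this route's names; finite-volume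
core = shared open item 0737 HaggDominationAllRanges): for couplings J with Σ k|J_k| < ∞ and J₂ +
Σ_(k≥3)(k−1)|J_k| ≤ 0, the alternating Hägg sequence (hcp, ABAB) minimises haggStackingEnergy J over
all Hägg sequences. Proof: H_n(s) − H_n(ABAB) ≥ B_n(−J₂ − Σ_(k≥3)(k−1)|J_k|) − Σ_(k≥3)(k−1)|J_k|
with B_n = #(m<n: s_m = s_(m+1)) (a distance-2 pair is aligned iff s changes sign; a k-window
differs from the alternating one only if it contains a non-change, (k−1) windows per non-change,
plus k−1 boundary windows); divide by n, liminf, haggStackingEnergy_alternating. [difficulty: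
provable-now] [PartayOrtnerCsanyi2017, RadinSchulman1983, BlancLewin2015]

TWO-LAYER PLAN. Foreseen glued splits (k ≤ 3, depth 1), nothing filed now: ClassOneEnergy ⇐
ClassOneBarlowReduction (class-wide analogue of the
shared open item 3062 PeriodicReductionToBarlow: the periodic infimum equals the infimum over
relaxed Barlow stackings, first in
the Lennard-Jones-like corner J₂ < 0) → ClassOneStackingPeriodic → thermodynamic-limit bookkeeping
(class analogue of 0626 +
BarlowEnergyIdentification 3065) → ClassOneEnergy. ClassOnePositional ⇐ class-wide BulkDefectVanish
(0751-type) →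
DefectVanishCrystallizes-type glue → ClassOnePositional. ClassOneStackingPeriodic ⇐ (dominated
corner: DominatedRegistrySelectsHcp,
filed) → (k₀ = 3: mirror domination selects ABC) → (frustrated k₀ ≥ 4: finite-range periodic ground
states by minimum mean cycle,
RadinSchulman1983 / Teubner1990, + a tail-stability lemma of StackingLockCertificate type,
KarpPeierlsStackingLock 3454).

KILL CRITERIA. A class-1 potential (IsOneCrossingMixture verified by explicit Bernstein inversion)
with a certified — or numerically robust and
then certified for one instance — non-periodic ground state or non-attained periodic infimum refutes
ClassOneEnergy and the
target: close `refuted:ClassOneEnergy` (the supports survive as lemmas for PoissonBesselStacking /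
HcpThetaUniversality).
ClassOneStackingPeriodic refuted at a PHYSICAL geometry (a near the zero-pressure spacing) ⇒ pivot:
add the repaired crux with the
extra hypothesis "J₂ < 0" (k₀ ≤ 2, the Lennard-Jones corner, decidable per potential by certified
numerics as in the shared item
LjRegistryDomination) and re-rank; refuted only at an unphysical density ⇒ repaired crux with a
density window. ClassOnePositional
refuted while ClassOneEnergy stands ⇒ the class is the right sea level for the energetic conjunct
only: keep ranks 3–4 and
re-glue through the LJ-specific positional item 0625 CrysPositional. Crystallization proved by a
Lennard-Jones-specific route
moots the assembly, not the class statements; bcc for a soft member is NOT a refutation (periodic).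

NOT DECOMPOSED YET. (i) The Mie one-switch theorem (card L2b/L3b): at zero pressure hcp beats fcc
for V = r⁻ⁿ/n − r⁻ᵐ/m iff g(m) > g(n) with
g(s) = log(A_hcp(s)/A_fcc(s))/s (A = lattice sum Σ r⁻ˢ at unit spacing; A_hcp > A_fcc for all s by
θ_fcc < θ_hcp,
BeterminPetrache2017, and Mellin); "exactly one switch n_c(m)" ⇔ unimodality of g on (3, ∞) — a
certified lattice-sum statement
matching the single boundary curve of BeterminSamajTravenec2022 Fig. 5; it decides WHICH minimiser,
which the conjunct does not ask,
so it waits as a child of ClassOneEnergy for the Mie sub-family. (ii) The Fourier half of L1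
(core-regularised V̂ has ≤ 1
interior extremum in |k|; recorded, not filed). (iii) The affine switch L2a (e_c(hcp) − e_c(fcc)
affine in the attraction
strength c). (iv) The bcc corner of the class (repulsion r⁻ⁿ, 3 < n < n_c, weak long-range
attraction: periodic, not Barlow) and
the non-Barlow competitor catalogue. (v) Thermodynamic-limit bookkeeping for the class
(periodisation, trial states, minimal
distance). (vi) A bundled predicate IsStableClassOnePotential replacing the five-conjunct inline
hypothesis (cosmetic; only if a
grounder asks).

CHEAPEST FALSIFIER. The card's census L4, run as a lookup: is there ANY one-component radial
potential with a one-crossing Bernstein density and a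
reported non-periodic (quasicrystalline / Frank–Kasper-aperiodic) T = 0 ground state? The known
one-component quasicrystal formers
checked on paper are all outside class 1 (Dzugutov1993: bump ⇒ no representation with one crossing;
Lennard-Jones–Gauss
EngelTrebin2007: second well; EngelEtAl2014: oscillating; LifshitzPetrich1997 two-ring designs: two
Fourier minima, impossible in
class 1 by the Fourier half of L1), Narasimhan–Jarić's square well is a non-smooth limit, not a
member, and the double-Yukawa
family of BeterminSamajTravenec2024 §4 is class 1 with only rectangular/square/triangular lattice
phases reported (2-D). The
cheapest COMPUTATION (not run in this one-shot planner seat; kit-free card): for Mie (n, m) on a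
grid of (3, 20]² and
h/a ∈ [0.78, 0.85], compute J_k = barlowCoupling to k ≤ 12 with tail bounds and solve the truncated
stacking model by minimum
mean cycle for K = 4, …, 12; an optimal period that keeps growing with K flags
ClassOneStackingPeriodic (and attainment in
ClassOneEnergy) as suspect.

NUMBERS. Lennard-Jones: w(t) = t⁵/1440 − t²/12, t₀ = 120^(1/3) ≈ 4.932, crossing length t₀^(-1/2) ≈
0.450 equilibrium distances;
e(hcp) below e(fcc) by ≈ 10⁻⁴ relative (KiharaKoba1952; BlancLewin2015 §2.3); Lennard-Jones registry
couplings J_k < 0 for all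
k ≥ 2 with |J_k| ≍ e^(−5.9 k) (route PoissonBesselStacking; the gen-1 review's f_k = 1/3 + (2/3) Re
C(k), Re C(1) = −1/2), i.e.
k₀ ≤ 2 and domination by orders of magnitude for Lennard-Jones; BeterminSamajTravenec2022 §3.1, Fig.
5: a single fcc/hcp
boundary in the (m, n) plane of Mie exponents, (12, 6) on the hcp side; θ_fcc(α) < θ_hcp(α) for all
α (BeterminPetrache2017
Thm 1.1). Items at open: 9 (1 target, 3 cruxes, 4 support, 1 assembly); Sketch.lean rc 0, 0 sorries.

DEFINITION REQUESTS. None needed now: IsOneCrossingMixture (OneCrossingMixture.lean, with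
isOneCrossingMixture_lennardJones proved) landed from the
predecessor's request; barlowCoupling / haggStackingEnergy / IsHaggSeq / alternatingHagg exist
(BarlowStackingEnergy.lean,
HaggStacking.lean, all proved, no named facts in the items' cone). Optional later: a bundled
IsStableClassOnePotential.

Novelty: Searches (2026-08-15, this seat): `lit frontier AtomisticToContinuum --since 2021` (30 rows;
crystallization-adjacent: arXiv:2407.20762
BeterminFurlanetto2026, arXiv:2604.19239 Kreutz–Ziereis polycrystal Γ-limit (read pp. 1–3: rigid
local-isometry energies, not pair
classes), arXiv:2605.07580 Luo–Wei "On ratios of theta functions" (read abstract: 2-D hexagonal,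
ratios/differences of theta and
Epstein zeta)); `lit search --source arxiv "Bétermin lattice energies"` (25: the Bétermin corpus
incl. arXiv:2312.01395 =
BeterminSamajTravenec2024 READ §2/§4: admissible class F = Gaussian mixtures of a Radon measure, F₊
= completely monotone, double
Yukawa has a one-crossing measure — 2-D rectangular lattices only); `lit search --source zbmath
"optimal and non-optimal lattices
non-completely monotone"` / `"Bétermin theta function lattice energy sign"` (1 each:
BeterminPetrache2019); `lit search --hybrid
"difference of completely monotone … sign of the measure"` (12 held books, none relevant); `lit
galaxy search "variation
diminishing" --star all` (37 rows: splines/TVD numerics only) and `"one-component quasicrystal"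
--star all` (0); OpenAlex / S2
daily budgets exhausted (HTTP 429), arXiv intermittently 429 — the card's two refuter audits (R7,
refuter-12; zbMATH + Crossref
sweeps, Sun–Song–Zou SAPM 2025 doi:10.1111/sapm.70092 flagged as newest lattice-only neighbour) are
relied on for those sources.
Nearest prior art found: Betermin2015 (arXiv:1502.03839 §4) and BeterminPetrache2019 (ar  [refs: 10.1111/sapm.70092, 2407.20762, 2604.19239, 2605.07580, 2312.01395, 1502.03839, 1806.02233, doi:10.1111/sapm.70092, BeterminFurlanetto2026, BeterminSamajTravenec2024, BeterminPetrache2019, Betermin2015, BeterminPetrache2017, BeterminSamajTravenec2022]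

Barriers (technique_class: total-positivity, bernstein-measure, potential-classes): - technique_class: total-positivity, bernstein-measure, potential-classes
- Literature.Barriers.AtomisticToContinuum.NoUniversallyOptimalLattice3D: class 0 (completely
monotone) has no 3-D optimum; the route lives in class 1, where ONE balance point t₀ selects density
and stacking, and makes no universal-optimality claim.
- Literature.Barriers.AtomisticToContinuum.Li2022_cohnElkies3D: no two-point LP /
Fourier-interpolation certificate is claimed or prescribed; the class statements are targets whose
proofs are open.
- Literature.Barriers.AtomisticToContinuum.SutoDegenerateGroundStates: Sütő's continuously
degenerate ground states need bounded V with compactly supported V̂ — not representable as a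
one-crossing mixture with divergent core; the class excludes them by hypothesis, which is exactly
why the generic strengthening is restricted to class 1.
- Literature.Barriers.AtomisticToContinuum.AperiodicTilingGroundStates: the generic "ground states
are periodic" fails for tilings / multi-state lattice gases; it does not evade by theorem — the bet
is that one species + radial + one crossing leaves no matching-rule-type forcing, and a single
class-1 aperiodic example closes the route (kill criterion).
- Literature.Barriers.AtomisticToContinuum.Hubbard1978_mostHomogeneous: bites
ClassOneStackingPeriodic: infinite-range convex repulsion at FIXED filling has Sturmian ground
states; partial evasion — the stacking functional has no conserved filling (zero pressure, the chain
picks its o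

History (route lifecycle, newest last):
- 2026-08-16T03:12:07Z · rev 4: dropped ClassOneTargetGlue — dedup after concurrent repair: ClassOneTargetGlue (stmt-14097, this seat, 02:59Z, FQ names) and TargetOfClassCruxes (stmt-14168, rbadge seat, 03:05Z, short name (planner-rchoice-AtomisticToContinuum-OneCrossi-e6fb89c7-0)
- 2026-08-23T12:48:25Z · DORMANT — reconciler: no traction for 6.1 d (last activity item-evidence-added at 2026-08-17T10:24:02Z); parked, not closed — `ledger route dormant route-AtomisticToConti (operator:999:3915737)

sub-problem: Crystallization · status: dormant · opened planner-plancard-AtomisticToContinuum-Crystal-27adde06-g2-0 2026-08-15T18:48:05Z · rev 6 · ledger route-AtomisticToContinuum-OneCrossingRisingSea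
GENERATED by the gate from the ledger (D-0016/17). Provers cite these decls: `theorem foo : Summit.AtomisticToContinuum.Crystallization.Theses.OneCrossingRisingSea.<Decl> := …` in Summits/AtomisticToContinuum/Crystallization/Theorems/<Name>.lean.
-/

namespace Summit.AtomisticToContinuum.Crystallization.Theses.OneCrossingRisingSea

open scoped BigOperators Topology Manifold Classical MeasureTheory ProbabilityTheory Matrix InnerProductSpace ComplexConjugate ContinuousMap
open Filter Set Function TopologicalSpace MeasureTheory

attribute [summit_statement] _root_.Crystallization

/-- item stmt-AtomisticToContinuum-12047 · target · rank 0 · open · by planner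
why it might fail: asserts 3-D crystallization for a whole class with arbitrarily soft members (cores ~ r^-3.1, tails ~ −r^-3.05); one class-1 potential with a quasicrystalline or infinitely degenerate aperiodic ground state — none known, none excluded — refutes it.
sources: Betermin2015, BeterminPetrache2019, BlancLewin2015, LifshitzPetrich1997, EngelEtAl2014
[target] X: every class-1 pair potential (one-crossing Gaussian mixture with divergent core, a
negative value, summable tail r^-(3+ε) and stability in ℝ³) has a periodic minimiser of the energy
per particle to which E(N)/N converges, and its ground states converge locally, up to translations
and subsequences, to a non-zero periodic point measure (card L3a; Lennard-Jones and Mie (n,m) with n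
> m > 3 are members, double-Yukawa in its stable range v₁κ₂² ≥ v₂κ₁² too; Morse is not (finite
core), Buckingham exp-6 is not (two sign changes, no lower bound); the class allows bcc — periodic,
not Barlow — for soft members). -/
@[route_item "route-AtomisticToContinuum-OneCrossingRisingSea"]
def ClassOneCrystallizes : Prop :=
  ∀ V : ℝ → ℝ, (Literature.MathematicalPhysics.StatisticalMechanics.IsOneCrossingMixture V ∧ Filter.Tendsto V (nhdsWithin 0 (Set.Ioi 0)) Filter.atTop ∧ (∃ r : ℝ, 0 < r ∧ V r < 0) ∧ (∃ C ε : ℝ, 0 < ε ∧ ∀ r : ℝ, 1 ≤ r → |V r| ≤ C * r ^ (-(3 + ε))) ∧ (∃ B : ℝ, ∀ (N : ℕ) (x : Fin N → EuclideanSpace ℝ (Fin 3)), Function.Injective x → -(B * (N : ℝ)) ≤ Literature.MathematicalPhysics.StatisticalMechanics.interactionEnergy V x)) → Literature.MathematicalPhysics.StatisticalMechanics.HasPeriodicGroundStateEnergy V 3 ∧ Literature.MathematicalPhysics.StatisticalMechanics.IsCrystallizing V 3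

/-- item stmt-AtomisticToContinuum-12048 · crux · rank 2 · open · by planner
why it might fail: 3-D positional rigidity for PAIR potentials is unknown even for Lennard-Jones (Flatley–Theil need a three-body term); at the fcc/hcp balance point of the class, or for soft tails, degenerate stackings are exact minimisers and translated ground states need not settle on one periodic pattern.
sources: BlancLewin2015, FlatleyTheil2015, Theil2006, BeterminPetrache2019
[crux] X_P: for every class-1 potential V, the energetic form HasPeriodicGroundStateEnergy V 3
implies the Blanc–Lewin positional form IsCrystallizing V 3 (card L3a, positional half; the step
where "one length scale ⇒ no aperiodic order" must become a rigidity theorem). [deps: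
ClassOneEnergy] [difficulty: open-problem] -/
@[route_item "route-AtomisticToContinuum-OneCrossingRisingSea", crux]
def ClassOnePositional : Prop :=
  ∀ V : ℝ → ℝ, (Literature.MathematicalPhysics.StatisticalMechanics.IsOneCrossingMixture V ∧ Filter.Tendsto V (nhdsWithin 0 (Set.Ioi 0)) Filter.atTop ∧ (∃ r : ℝ, 0 < r ∧ V r < 0) ∧ (∃ C ε : ℝ, 0 < ε ∧ ∀ r : ℝ, 1 ≤ r → |V r| ≤ C * r ^ (-(3 + ε))) ∧ (∃ B : ℝ, ∀ (N : ℕ) (x : Fin N → EuclideanSpace ℝ (Fin 3)), Function.Injective x → -(B * (N : ℝ)) ≤ Literature.MathematicalPhysics.StatisticalMechanics.interactionEnergy V x)) → Literature.MathematicalPhysics.StatisticalMechanics.HasPeriodicGroundStateEnergy V 3 → Literature.MathematicalPhysics.StatisticalMechanics.IsCrystallizing V 3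

/-- item stmt-AtomisticToContinuum-12049 · crux · rank 3 · open · by planner
why it might fail: attainment can fail inside class 1: for soft members the registry couplings are + for k < k₀ (k₀ ≥ 4) then −, a frustrated ANNNI-type chain whose optimal period may diverge at multiphase points (FisherSzpilka1987, BakBruinsma1982); non-Barlow competitors for soft cores are untested.
sources: BlancLewin2015, BeterminSamajTravenec2022, BeterminPetrache2019, FisherSzpilka1987, Hubbard1978, BakBruinsma1982
[crux] X_E: for every class-1 potential V, the minimum of the energy per particle over periodic
configurations of ℝ³ is attained and E(N)/N converges to it (card L3a, energetic half; for
Lennard-Jones this is the conjunct's first half with hcp-type expected, for soft members bcc or fcc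
— the class does not promise close packing). [difficulty: open-problem] -/
@[route_item "route-AtomisticToContinuum-OneCrossingRisingSea", crux]
def ClassOneEnergy : Prop :=
  ∀ V : ℝ → ℝ, (Literature.MathematicalPhysics.StatisticalMechanics.IsOneCrossingMixture V ∧ Filter.Tendsto V (nhdsWithin 0 (Set.Ioi 0)) Filter.atTop ∧ (∃ r : ℝ, 0 < r ∧ V r < 0) ∧ (∃ C ε : ℝ, 0 < ε ∧ ∀ r : ℝ, 1 ≤ r → |V r| ≤ C * r ^ (-(3 + ε))) ∧ (∃ B : ℝ, ∀ (N : ℕ) (x : Fin N → EuclideanSpace ℝ (Fin 3)), Function.Injective x → -(B * (N : ℝ)) ≤ Literature.MathematicalPhysics.StatisticalMechanics.interactionEnergy V x)) → Literature.MathematicalPhysics.StatisticalMechanics.HasPeriodicGroundStateEnergy V 3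

/-- item stmt-AtomisticToContinuum-12050 · crux · rank 4 · open · by planner
why it might fail: frustration: if J₂, J₃ > 0 > J₄,… no Barlow stacking avoids every penalty (pigeonhole on 4 layers) and the infinite-range tail may push the optimal period to infinity at multiphase points (FisherSzpilka1987, Hubbard1978 barrier); "every a" includes unphysical densities.
sources: FisherSzpilka1987, RadinSchulman1983, Hubbard1978, BeterminPetrache2017, PartayOrtnerCsanyi2017, RegevStephensdavidowitz2017
[crux] for every class-1 potential V and every ideal Barlow geometry (in-layer spacing a > 0, layer
spacing h with h² = 2a²/3), the one-dimensional stacking model with couplings J_k = barlowCoupling V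
a h k (aligned minus non-aligned layer interaction) has a PERIODIC Hägg sequence minimising the
stacking energy density haggStackingEnergy among all Hägg sequences — the class-wide form of
stacking selection, whose only structural input is the one-crossing sign pattern of J
(ClassOneRegistryOneCrossing); in the dominated corner J₂ + Σ_(k≥3)(k−1)|J_k| ≤ 0 it is
DominatedRegistrySelectsHcp (witness: ABAB, period 2); foreseen child of ClassOneEnergy. [deps:
ClassOneRegistryOneCrossing, DominatedRegistrySelectsHcp] [difficulty: L] -/
@[route_item "route-AtomisticToContinuum-OneCrossingRisingSea"]
def ClassOneStackingPeriodic : Prop :=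
  ∀ V : ℝ → ℝ, (Literature.MathematicalPhysics.StatisticalMechanics.IsOneCrossingMixture V ∧ Filter.Tendsto V (nhdsWithin 0 (Set.Ioi 0)) Filter.atTop ∧ (∃ r : ℝ, 0 < r ∧ V r < 0) ∧ (∃ C ε : ℝ, 0 < ε ∧ ∀ r : ℝ, 1 ≤ r → |V r| ≤ C * r ^ (-(3 + ε))) ∧ (∃ B : ℝ, ∀ (N : ℕ) (x : Fin N → EuclideanSpace ℝ (Fin 3)), Function.Injective x → -(B * (N : ℝ)) ≤ Literature.MathematicalPhysics.StatisticalMechanics.interactionEnergy V x)) → ∀ a h : ℝ, 0 < a → 0 < h → h ^ 2 = 2 / 3 * a ^ 2 → ∃ (s : ℤ → ℤ) (p : ℕ), Literature.MathematicalPhysics.StatisticalMechanics.IsHaggSeq s ∧ 0 < p ∧ (∀ i : ℤ, s (i + p) = s i) ∧ ∀ s' : ℤ → ℤ, Literature.MathematicalPhysics.StatisticalMechanics.IsHaggSeq s' → Literature.MathematicalPhysics.StatisticalMechanics.haggStackingEnergy (Literature.MathematicalPhysics.StatisticalMechanics.barlowCoupling V a h) s ≤ Literature.MathematicalPhysics.StatisticalMechanics.haggStackingEnergy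 (Literature.MathematicalPhysics.StatisticalMechanics.barlowCoupling V a h) s'

/-- item stmt-AtomisticToContinuum-12051 · support · rank 9 · open · by planner
sources: BlancLewin2015, BeterminPetrache2019, Schoenberg1938
[support] Lennard-Jones is class 1: IsOneCrossingMixture lennardJones (PROVED in tree:
isOneCrossingMixture_lennardJones, density t⁵/1440 − t²/12, t₀ = 120^(1/3)); divergent core (r⁻¹²/12
dominates as r → 0⁺); V(1) = −1/12 < 0 (lennardJones_one); |V(r)| ≤ r⁻⁶/4 for r ≥ 1 (ε = 3);
stability in ℝ³ = lennardJones_stable_holds 3 (PROVED, StablePotentialsProofs). The only hypothesis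
of `closes` that is not a conjecture. [difficulty: provable-now] -/
@[route_item "route-AtomisticToContinuum-OneCrossingRisingSea", crux]
def LennardJonesClassOne : Prop :=
  Literature.MathematicalPhysics.StatisticalMechanics.IsOneCrossingMixture Literature.MathematicalPhysics.StatisticalMechanics.lennardJones ∧ Filter.Tendsto Literature.MathematicalPhysics.StatisticalMechanics.lennardJones (nhdsWithin 0 (Set.Ioi 0)) Filter.atTop ∧ (∃ r : ℝ, 0 < r ∧ Literature.MathematicalPhysics.StatisticalMechanics.lennardJones r < 0) ∧ (∃ C ε : ℝ, 0 < ε ∧ ∀ r : ℝ, 1 ≤ r → |Literature.MathematicalPhysics.StatisticalMechanics.lennardJones r| ≤ C * r ^ (-(3 + ε))) ∧ (∃ B : ℝ, ∀ (N : ℕ) (x : Fin N → EuclideanSpace ℝ (Fin 3)), Function.Injective x → -(B * (N : ℝ)) ≤ Literature.MathematicalPhysics.StatisticalMechanics.interactionEnergy Literature.MathematicalPhysics.StatisticalMechanics.lennardJones x)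

/-- item stmt-AtomisticToContinuum-12052 · support · rank 9 · open · by planner
sources: Karlin1968, PolyaSzego1925, Schoenberg1938, Dzugutov1993, EngelTrebin2007
[support] one crossing in real space (card L1, real half): a one-crossing Gaussian mixture with
divergent core and a negative value has exactly one well — there is r₀ > 0 with V strictly
decreasing on (0, r₀] and strictly increasing on [r₀, ∞) (no shoulder, no bump, no second minimum:
the Dzugutov / Lennard-Jones–Gauss mechanisms for one-component quasicrystals are unavailable in
class 1). Proof sketch: V′(r) = −2r g(r²), g(s) = ∫ t e^(-ts) w(t) dt, and e^(t₀ s) g(s) is strictly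
decreasing; V → 0 at ∞ by dominated convergence, so the crossing of g exists. [difficulty: M] -/
@[route_item "route-AtomisticToContinuum-OneCrossingRisingSea"]
def ClassOneSingleWell : Prop :=
  ∀ V : ℝ → ℝ, (Literature.MathematicalPhysics.StatisticalMechanics.IsOneCrossingMixture V ∧ Filter.Tendsto V (nhdsWithin 0 (Set.Ioi 0)) Filter.atTop ∧ (∃ r : ℝ, 0 < r ∧ V r < 0)) → ∃ r₀ : ℝ, 0 < r₀ ∧ StrictAntiOn V (Set.Ioc 0 r₀) ∧ StrictMonoOn V (Set.Ici r₀)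

/-- item stmt-AtomisticToContinuum-12053 · support · rank 9 · open · by planner
sources: RegevStephensdavidowitz2017, BeterminPetrache2017, Karlin1968, PolyaSzego1925
[support] one crossing survives the layer sums (card L1/L2 engine): for a one-crossing Gaussian
mixture V with summable tail and any triangular-layer geometry a, h > 0, the registry couplings k ↦
J_k = barlowCoupling V a h k (k ≥ 1) change sign at most once and only from + to −: J_(k₁) ≤ 0 ⇒
J_(k₂) ≤ 0 for k₂ ≥ k₁. Proof sketch: J_k = D(kh), D(z) = ∫ e^(-t z²) F(t) w(t) dt with F(t) =
Θ_Λ(t) − Θ_(Λ+w)(t) ≥ 0 (shifted-Gaussian-mass inequality, RegevStephensdavidowitz2017 Thm 1.1 /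
BeterminPetrache2017; for the triangular lattice it reduces to two rectangular sublattices and
Mathlib's jacobiTheta₂ functional equation), and s ↦ e^(t₀ s) D(√s) is non-increasing. [difficulty:
M] -/
@[route_item "route-AtomisticToContinuum-OneCrossingRisingSea"]
def ClassOneRegistryOneCrossing : Prop :=
  ∀ V : ℝ → ℝ, (Literature.MathematicalPhysics.StatisticalMechanics.IsOneCrossingMixture V ∧ (∃ C ε : ℝ, 0 < ε ∧ ∀ r : ℝ, 1 ≤ r → |V r| ≤ C * r ^ (-(3 + ε)))) → ∀ a h : ℝ, 0 < a → 0 < h → ∀ k₁ k₂ : ℕ, 1 ≤ k₁ → k₁ ≤ k₂ → Literature.MathematicalPhysics.StatisticalMechanics.barlowCoupling V a h k₁ ≤ 0 → Literature.MathematicalPhysics.StatisticalMechanics.barlowCoupling V a h k₂ ≤ 0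

/-- item stmt-AtomisticToContinuum-12054 · support · rank 9 · open · by planner
sources: PartayOrtnerCsanyi2017, RadinSchulman1983, BlancLewin2015
[support] Hägg domination, infinite volume (the reviewer's recommended child of
ClassOneStackingPeriodic; restates the superseded route RefuteCrystalPeriodicMin's item 0671
RefuteCrys1dGroundstate over this route's names; finite-volume core = shared open item 0737
HaggDominationAllRanges): for couplings J with Σ k|J_k| < ∞ and J₂ + Σ_(k≥3)(k−1)|J_k| ≤ 0, the
alternating Hägg sequence (hcp, ABAB) minimises haggStackingEnergy J over all Hägg sequences. Proof:
H_n(s) − H_n(ABAB) ≥ B_n(−J₂ − Σ_(k≥3)(k−1)|J_k|) − Σ_(k≥3)(k−1)|J_k| with B_n = #(m<n: s_m =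
s_(m+1)) (a distance-2 pair is aligned iff s changes sign; a k-window differs from the alternating
one only if it contains a non-change, (k−1) windows per non-change, plus k−1 boundary windows);
divide by n, liminf, haggStackingEnergy_alternating. [difficulty: provable-now] -/
@[route_item "route-AtomisticToContinuum-OneCrossingRisingSea"]
def DominatedRegistrySelectsHcp : Prop :=
  ∀ J : ℕ → ℝ, Summable (fun k : ℕ => (k : ℝ) * |J k|) → J 2 + ∑' k : ℕ, (if 3 ≤ k then ((k : ℝ) - 1) * |J k| else 0) ≤ 0 → IsLeast (Set.range fun s : {s : ℤ → ℤ // Literature.MathematicalPhysics.StatisticalMechanics.IsHaggSeq s} => Literature.MathematicalPhysics.StatisticalMechanics.haggStackingEnergy J s.1) (Literature.MathematicalPhysics.StatisticalMechanics.haggStackingEnergy J Literature.MathematicalPhysics.StatisticalMechanics.alternatingHagg)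

/-- item stmt-AtomisticToContinuum-14407 · support · rank 9 · open · by planner
sources: BlancLewin2015
[support] glue to the target (badge repair, D-0019/A11): the target X = ClassOneCrystallizes is,
pointwise in the class-1 potential V, the conjunction of the energetic crux X_E = ClassOneEnergy and
the positional crux X_P = ClassOnePositional (which is stated given X_E); hence ClassOneEnergy →
ClassOnePositional → ClassOneCrystallizes by instantiation, fun hE hP V hV => ⟨hE V hV, hP V hV (hE
V hV)⟩ (sorry-free in the planner's Sketch.lean; the converse ClassOneCrystallizes → ClassOneEnergy
∧ ClassOnePositional holds too). Provable now by anyone idle; it carries no mathematics — it records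
in the item graph that closing the two class cruxes closes the target, exactly as `closes` records
that they (with LennardJonesClassOne) decide the sub-problem. [deps: ClassOneEnergy,
ClassOnePositional, ClassOneCrystallizes] [difficulty: provable-now] -/
@[route_item "route-AtomisticToContinuum-OneCrossingRisingSea"]
def TargetOfClassCruxes : Prop :=
  ClassOneEnergy → ClassOnePositional → ClassOneCrystallizes

/-- item stmt-AtomisticToContinuum-12055 · assembly · rank 1 · open · by planner
sources: BlancLewin2015
[assembly] ClassOneEnergy → ClassOnePositional → LennardJonesClassOne → Crystallization (the
sub-problem Statement decl, by name). -/
@[route_item "route-AtomisticToContinuum-OneCrossingRisingSea"]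
def Assembly : Prop :=
  ClassOneEnergy → ClassOnePositional → LennardJonesClassOne → _root_.Crystallization

/-! D-0027 §2.1 — DECIDING THEOREM (planner-authored via `route open/edit --closes-file`; by planner-plancard-AtomisticToContinuum-Crystal-27adde06-g2-0 2026-08-15T18:48:06Z):
its hypotheses are this route's items and its conclusion the sub-problem Statement (glue_lint), and it elaborates with this file. -/

@[closes "route-AtomisticToContinuum-OneCrossingRisingSea"] theorem closes (hE : ClassOneEnergy) (hP : ClassOnePositional) (hLJ : LennardJonesClassOne) :
    _root_.Crystallization :=
  ⟨hE _ hLJ, hP _ hLJ (hE _ hLJ)⟩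

end Summit.AtomisticToContinuum.Crystallization.Theses.OneCrossingRisingSea
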